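import Summits.CriticalPhenomena.PercolationContinuityZ3.Theorems.Transplant.PlanarSkeletonFrmScaledCoarseMulti
import Summits.CriticalPhenomena.PercolationContinuityZ3.Theorems.Transplant.PlanarSkeletonFrmScaledRays
import Summits.CriticalPhenomena.PercolationContinuityZ3.Theorems.Transplant.SkelFrmFromProxHoldsAll
import HarnessLib

/-!
# THE MULTI-TYPE SCALED NODE UNDER STEP TRANSLATIONS (weaker than chart-alignment; refuter p5-g27's remark (3) made a kernel theorem, GEN pen gen-1 g3 2026-08-27):
# **`θ_v(p_c) = 0` at EVERY vertex of every locally finite graph carrying a `PlanarSkeletonFrmScaled` with ANY number of types and `L ≤ N` whose two exact steps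
# `N e₀`, `N e₁` are translation vectors of chart-translating automorphisms** — no hypothesis on the types at all

builds on p205010 (kernel theorem, internal audit signed; external expert review pending).  Lane `prim-bschramm`, seat `prim-bschramm-gen-1` g3 (GEN pen, p3-lineage
brief); helper file (`--supports stmt-CriticalPhenomena-4575 --as helper`); PROOFS ONLY, def-free.  Nothing here edits or declares a `@[conjecture]`; nothing is claimed
about skeletons whose steps are not frame translations (e.g. types swapped by the steps), `L > N`, chartless classes, the end state or Conj. 4 in general.
WHY (the aligned node «SkelFrmScaledAlignedHoldsAll» p490798 revisited): its proxies («PlanarSkeletonFrmScaledCoarseMulti» `exists_proxies_of_aligned`, p490515) used the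
alignment of the types ONLY through '`N ℤ² ⊆` translation vectors' — for a vertex `c` framed from its type `s` the realiser target `φ s + proxyVec t c − φ t` equals
`(φ c + proxyVec t c − φ t) − (φ c − φ s)`, an `N ℤ²`-vector minus a frame translation.  So the hypothesis shrinks to TWO automorphisms:
`∀ i : Fin 2, ∃ α : G ≃g G, ∀ w, Φ.φ (α w) = Φ.φ w + Pi.single i (Φ.N : ℤ)` (the exact steps are frame translations) — implied by alignment
(`exists_translate_Nvec_of_aligned`), by one type (`exists_stepTranslations_of_types_eq`), and automatic for every coset chart of a Cayley graph after max-area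
re-basing (p5-g27 #5839 (3)); it fails exactly when the steps swap alignment classes of types.
* §1 `exists_translate_Nvec_of_steps` (two automorphisms ⇒ all of `N ℤ²`, by composing/inverting), `exists_stepTranslations_of_types_eq`;
* §2 **`exists_proxies_of_stepTranslations`** — part 4's / p490515's proxy conclusion VERBATIM under `N ℤ² ⊆` translations, for EVERY vertex `t` (same construction);
* §3 **`frmScaledSteps_criticalContinuity_holds (Φ) (hLN : Φ.L ≤ Φ.N) (hT : ∀ i, ∃ α : G ≃g G, φ ∘ α = φ + N eᵢ) (v : V) : theta G v (criticalProbIOf G v) = 0`** (the coarse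
  skeleton of p490515 §2–§3 built inline + §2 + p486426 `frmFromProx_criticalContinuity_holds`), the drop form, and the From-carrier form
  `frmFromSteps_criticalContinuity_holds (Φ : PlanarSkeletonFrmFrom G) (hT : ∀ i, ∃ α, φ ∘ α = φ + eᵢ) (v)` through `toFrmScaled`.
[cite: BenjaminiSchramm1996, Conj. 4; §2 (almost transitive graphs)] [cite: KozmaNitzan2024, §1 p. 2 (approach 1); §4 p. 15, p. 16 (Lemma 8), pp. 19–21, Theorem 6]
[cite: Hutchcroft2016, Thm. 1] [cite: LyonsPeres2016, Thm. 7.6] [cite: AizenmanGrimmett1991, Thm 1 (essential enhancements)] [this work]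
-/

noncomputable section

namespace Summit.CriticalPhenomena.PercolationContinuityZ3.Theorems

namespace Transplant

open MeasureTheory Literature.Probability.Percolation Literature.Probability.LatticeModels SimpleGraph
open Literature.Barriers.CriticalPhenomena (graphBall mem_graphBall_self graphBall_mono mem_graphBall_map countable_of_connected_of_locallyFinite)
open scoped Classical

namespace PlanarSkeletonFrmScaled

variable {V : Type} {G : SimpleGraph V} [G.LocallyFinite] (Φ : PlanarSkeletonFrmScaled G)

/-! ## §1 From two automorphisms to the step lattice `N ℤ²`; one type -/

/-- **From two automorphisms to the whole step lattice**: if the exact steps `N e₀`, `N e₁` are translation vectors of chart-translating automorphisms, so is every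
vector of `N ℤ²` (compose and invert, §1). [folklore] -/
theorem exists_translate_Nvec_of_steps (hT : ∀ i : Fin 2, ∃ α : G ≃g G, ∀ w, Φ.φ (α w) = Φ.φ w + Pi.single i (Φ.N : ℤ)) (z : Site 2) :
    ∃ α : G ≃g G, ∀ w, Φ.φ (α w) = Φ.φ w + fun i => (Φ.N : ℤ) * z i := by
  have hline : ∀ (i : Fin 2) (x : ℤ), ∃ α : G ≃g G, ∀ w, Φ.φ (α w) = Φ.φ w + Pi.single i ((Φ.N : ℤ) * x) := by
    intro i x
    obtain ⟨αi, hαi⟩ := hT i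
    induction x using Int.induction_on with
    | zero => exact ⟨RelIso.refl _, fun w => by rw [mul_zero, Pi.single_zero, add_zero]; rfl⟩
    | succ n ih =>
      obtain ⟨β, hβ⟩ := ih
      refine ⟨β.trans αi, fun w => ?_⟩
      rw [Φ.frame_trans hβ hαi w, ← Pi.single_add, mul_add, mul_one]
    | pred n ih =>
      obtain ⟨β, hβ⟩ := ih
      refine ⟨β.trans αi.symm, fun w => ?_⟩
      rw [Φ.frame_trans hβ (Φ.frame_symm hαi) w, ← Pi.single_neg, ← Pi.single_add, mul_sub, mul_one, sub_eq_add_neg]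
  obtain ⟨α₀, hα₀⟩ := hline 0 (z 0)
  obtain ⟨α₁, hα₁⟩ := hline 1 (z 1)
  refine ⟨α₀.trans α₁, fun w => ?_⟩
  rw [Φ.frame_trans hα₀ hα₁ w]
  congr 1
  funext i
  fin_cases i <;> simp

/-- **One type ⇒ the exact steps are frame translations** (the step neighbours of the base vertex are framed from it). [folklore] -/
theorem exists_stepTranslations_of_types_eq {t : V} (h1 : Φ.types = {t}) (i : Fin 2) :
    ∃ α : G ≃g G, ∀ w, Φ.φ (α w) = Φ.φ w + Pi.single i (Φ.N : ℤ) := by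
  obtain ⟨w₀, -, hw₀⟩ := Φ.step t i 1
  obtain ⟨α, hα⟩ := Φ.exists_translate_sub_of_aligned (Φ.aligned_of_types_eq h1) w₀
  refine ⟨α, fun w => ?_⟩
  rw [hα w, hw₀, Units.val_one, mul_one, add_sub_cancel_left]

/-! ## §2 Base-type proxies from step translations (any number of types, every vertex) -/

/-- **BASE-TYPE PROXIES FROM STEP TRANSLATIONS — no hypothesis on the types.**  On a connected graph carrying a scaled skeleton (ANY number of types) for which every
vector of `N ℤ²` is the translation vector of a chart-translating automorphism (e.g. the two exact steps are, `exists_translate_Nvec_of_steps`; or the types are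
aligned, `exists_translate_Nvec_of_aligned`), EVERY vertex `t` has the proxies of `exists_proxies_of_aligned`: one radius `D` such that every `c` has `c′` framed
from `t` by an automorphism translating `φ` by the `N`-divisible vector `φ c′ − φ t`, in the same coarse cell as `c`, within graph distance `D` both ways.  (The proof
of `exists_proxies_of_aligned` used alignment only through `N ℤ² ⊆` translations: for `c` framed from its type `s` the realiser target `φ s + proxyVec t c − φ t =
(φ c + proxyVec t c − φ t) − (φ c − φ s)` is an `N ℤ²`-vector minus a frame translation — refuter p5-g27's remark (3), 2026-08-27.)
[cite: KozmaNitzan2024, §4 p. 15, pp. 19–21 ((21)–(25))] [this work] -/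
theorem exists_proxies_of_stepTranslations (hc : G.Connected) (t : V)
    (hT : ∀ z : Site 2, ∃ α : G ≃g G, ∀ w, Φ.φ (α w) = Φ.φ w + fun i => (Φ.N : ℤ) * z i) :
    ∃ D : ℕ, ∀ c : V, ∃ (c' : V) (α : G ≃g G), α t = c' ∧ (∀ w, Φ.φ (α w) = Φ.φ w + (Φ.φ c' - Φ.φ t)) ∧
      (∀ i, (Φ.N : ℤ) ∣ (Φ.φ c' - Φ.φ t) i) ∧ (∀ w, Φ.coarse (α w) = Φ.coarse w + (Φ.coarse c' - Φ.coarse t)) ∧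
      Φ.coarse c' = Φ.coarse c ∧ c ∈ graphBall G c' D ∧ c' ∈ graphBall G c D := by
  have hN := Φ.N_pos
  -- one realiser, framed from `t`, per (fine type, offset) pair that occurs, with a walk from the type
  have hreal : ∀ sd : V × Site 2, ∃ (u : V) (n : ℕ),
      ((∃ c : V, (∃ α : G ≃g G, α sd.1 = c ∧ ∀ w, Φ.φ (α w) = Φ.φ w + (Φ.φ c - Φ.φ sd.1)) ∧ Φ.proxyVec t c = sd.2) →
        (∃ γ : G ≃g G, γ t = u ∧ ∀ w, Φ.φ (γ w) = Φ.φ w + (Φ.φ u - Φ.φ t)) ∧ Φ.φ u = Φ.φ sd.1 + sd.2) ∧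
      u ∈ graphBall G sd.1 n := by
    rintro ⟨s, d⟩
    by_cases hsd : ∃ c : V, (∃ α : G ≃g G, α s = c ∧ ∀ w, Φ.φ (α w) = Φ.φ w + (Φ.φ c - Φ.φ s)) ∧ Φ.proxyVec t c = d
    · obtain ⟨c, ⟨αc, -, hαc⟩, hcd⟩ := hsd
      have hq : ∀ i, ∃ q : ℤ, (Φ.φ c i - Φ.φ t i) + d i = (Φ.N : ℤ) * q := fun i => by
        rw [← hcd]; exact dvd_proxyOff (Φ.N : ℤ) (Φ.φ c i) (Φ.φ t i)
      choose q hq using hq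
      obtain ⟨αN, hαN⟩ := hT q
      have hγ : ∀ w, Φ.φ ((αc.symm.trans αN) w) = Φ.φ w + (Φ.φ s + d - Φ.φ t) := by
        intro w
        rw [Φ.frame_trans (Φ.frame_symm hαc) hαN w]
        congr 1
        funext i
        simp only [Pi.add_apply, Pi.sub_apply, Pi.neg_apply]
        have := hq i
        linarith
      obtain ⟨W⟩ := hc.preconnected s ((αc.symm.trans αN) t)
      refine ⟨(αc.symm.trans αN) t, W.length, fun _ => ⟨⟨αc.symm.trans αN, rfl, fun w => ?_⟩, ?_⟩, ⟨W, le_rfl⟩⟩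
      · rw [hγ w, hγ t]; abel
      · rw [hγ t]; abel
    · exact ⟨s, 0, fun h => absurd h hsd, mem_graphBall_self G s 0⟩
  choose u n hu hun using hreal
  set B : Finset (Site 2) := Fintype.piFinset fun _ : Fin 2 => Finset.Icc (-(Φ.N : ℤ)) Φ.N with hB
  have hmemB : ∀ c, Φ.proxyVec t c ∈ B := fun c => by
    rw [hB, Fintype.mem_piFinset]
    intro i
    rw [Finset.mem_Icc]
    exact (mem_box.1 (Φ.proxyVec_mem_box t c)) i
  refine ⟨(Φ.types ×ˢ B).sup n, fun c => ?_⟩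
  obtain ⟨s, hs, αc, hαcs, hαc⟩ := Φ.frame c
  set d := Φ.proxyVec t c with hd
  have hsdmem : (s, d) ∈ Φ.types ×ˢ B := Finset.mem_product.2 ⟨hs, hmemB c⟩
  obtain ⟨⟨γ, hγt, hγ⟩, hφu⟩ := hu (s, d) ⟨c, ⟨αc, hαcs, hαc⟩, rfl⟩
  set c' : V := αc (u (s, d)) with hc'
  have hφc' : Φ.φ c' = Φ.φ c + d := by
    rw [hc', hαc (u (s, d)), hφu]; abel
  have hdvd : ∀ i, (Φ.N : ℤ) ∣ (Φ.φ c' - Φ.φ t) i := by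
    intro i
    rw [Pi.sub_apply, hφc', Pi.add_apply]
    have := dvd_proxyOff (Φ.N : ℤ) (Φ.φ c i) (Φ.φ t i)
    have e : Φ.φ c i + d i - Φ.φ t i = Φ.φ c i - Φ.φ t i + proxyOff (Φ.N : ℤ) (Φ.φ c i) (Φ.φ t i) := by rw [hd]; unfold proxyVec; ring
    rw [e]; exact this
  have hα : ∀ w, Φ.φ ((γ.trans αc) w) = Φ.φ w + (Φ.φ c' - Φ.φ t) := by
    intro w
    rw [Φ.frame_trans hγ hαc w, hφc', hφu]
    abel
  have hαt : (γ.trans αc) t = c' := by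
    show αc (γ t) = c'
    rw [hγt]
  have hcell : Φ.coarse c' = Φ.coarse c := by
    funext i
    rw [coarse_apply, coarse_apply, hφc', Pi.add_apply, hd]
    exact ediv_add_proxyOff hN (Φ.φ c i) (Φ.φ t i)
  have hcoarse : ∀ w, Φ.coarse ((γ.trans αc) w) = Φ.coarse w + (Φ.coarse c' - Φ.coarse t) := by
    intro w
    rw [Φ.coarse_translate_of_dvd hα hdvd w]
    congr 1
    funext i
    obtain ⟨q, hq⟩ := hdvd i
    rw [Pi.sub_apply] at hq
    have hv : Φ.φ c' i = Φ.φ t i + q * (Φ.N : ℤ) := by linarith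
    rw [Pi.sub_apply, Pi.sub_apply, hq, Int.mul_ediv_cancel_left _ hN.ne', coarse_apply, coarse_apply, hv, Int.add_mul_ediv_right _ _ hN.ne']
    ring
  have hnD : n (s, d) ≤ (Φ.types ×ˢ B).sup n := Finset.le_sup (f := n) hsdmem
  have hcc' : c' ∈ graphBall G c ((Φ.types ×ˢ B).sup n) := by
    have h := mem_graphBall_map αc (hun (s, d))
    rw [hαcs] at h
    exact graphBall_mono G c hnD h
  have hc'c : c ∈ graphBall G c' ((Φ.types ×ˢ B).sup n) := by
    obtain ⟨w', hw'⟩ := hcc'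
    exact ⟨w'.reverse, by rw [SimpleGraph.Walk.length_reverse]; exact hw'⟩
  exact ⟨c', γ.trans αc, hαt, hα, hdvd, hcoarse, hcell, hc'c, hcc'⟩

end PlanarSkeletonFrmScaled

/-! ## §3 The node under step translations: `θ_v(p_c) = 0` at every vertex; the From carrier -/

/-- **THE MULTI-TYPE SCALED NODE UNDER STEP TRANSLATIONS — `θ_v(p_c(G,v)) = 0` AT EVERY VERTEX**: on a locally finite graph carrying a `PlanarSkeletonFrmScaled Φ` with
ANY number of base-vertex types and `Φ.L ≤ Φ.N`, if the two exact steps are translation vectors of chart-translating automorphisms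
(`∀ i, ∃ α : G ≃g G, φ ∘ α = φ + N eᵢ`), then Bernoulli bond percolation has no infinite cluster at criticality at every vertex.  Proof: the coarse chart `⌊φ/N⌋` with
the residue types `T ∋ v` of `exists_coarseTypesAt` is a multi-type `PlanarSkeletonFrmFrom` (p490515 §2–§3), it has proxies of type `v` by
`exists_proxies_of_stepTranslations`, and p486426 `frmFromProx_criticalContinuity_holds` applies on the same graph at the same vertex.  The aligned node
`frmScaledAligned_criticalContinuity_holds` (p490798) and the one-type rider form are special cases (`exists_translate_Nvec_of_aligned`,
`exists_stepTranslations_of_types_eq`).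
builds on p205010 (kernel theorem, internal audit signed; external expert review pending). [cite: BenjaminiSchramm1996, Conj. 4; §2] [cite: KozmaNitzan2024, §4] -/
theorem frmScaledSteps_criticalContinuity_holds {V : Type} (G : SimpleGraph V) [G.LocallyFinite] (Φ : PlanarSkeletonFrmScaled G) (hLN : Φ.L ≤ Φ.N)
    (hT : ∀ i : Fin 2, ∃ α : G ≃g G, ∀ w, Φ.φ (α w) = Φ.φ w + Pi.single i (Φ.N : ℤ)) (v : V) :
    theta G v (criticalProbIOf G v) = 0 := by
  obtain ⟨t₀, ht₀, -⟩ := Φ.frame v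
  have hc : G.Connected := Φ.graph_connected ht₀
  obtain ⟨T, hvT, -, hfr⟩ := Φ.exists_coarseTypesAt v
  obtain ⟨D, hD⟩ := Φ.exists_proxies_of_stepTranslations hc v (Φ.exists_translate_Nvec_of_steps hT)
  have hP : PlanarSkeletonFrmFrom.HasProxies
      (⟨Φ.coarse, Φ.coarse_lip hLN, T, hfr, Φ.Δ, Φ.degree_le, Φ.steps_coarse, max Φ.ℓ₀ 1, Φ.coarse_cylConnFrom' T⟩ : PlanarSkeletonFrmFrom G) v D := by
    intro c
    obtain ⟨c', α, hαt, -, -, hcoarse, hcell, hcD, -⟩ := hD c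
    exact ⟨c', α, hαt, hcoarse, hcell, hcD⟩
  exact frmFromProx_criticalContinuity_holds G _ hvT hP

/-- **The same-`p` drop at every vertex under step translations** — every density `p` with `θ_v(p) > 0` admits `q < p` with `θ_v(q) > 0`; no uniqueness, Φ2 or
`p < 1` hypothesis. builds on p205010 (kernel theorem, internal audit signed; external expert review pending). [cite: BenjaminiSchramm1996, Conj. 4] -/
theorem frmScaledSteps_drop_holds {V : Type} (G : SimpleGraph V) [G.LocallyFinite] (Φ : PlanarSkeletonFrmScaled G) (hLN : Φ.L ≤ Φ.N)
    (hT : ∀ i : Fin 2, ∃ α : G ≃g G, ∀ w, Φ.φ (α w) = Φ.φ w + Pi.single i (Φ.N : ℤ)) (v : V) (p : unitInterval) (hθ : 0 < theta G v p) :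
    ∃ q : unitInterval, (q : ℝ) < p ∧ 0 < theta G v q := by
  obtain ⟨t₀, ht₀, -⟩ := Φ.frame v
  haveI : Countable V := countable_of_connected_of_locallyFinite G (Φ.graph_connected ht₀) v
  exact drop_at_of_critical G v (P := fun _ => True) (fun _ => frmScaledSteps_criticalContinuity_holds G Φ hLN hT v) p trivial hθ

/-- **THE MULTI-TYPE NODE UNDER STEP TRANSLATIONS ON THE FROM CARRIER** (`L = N = 1`): every locally finite graph carrying a `PlanarSkeletonFrmFrom` with any number of
types whose two unit steps `e₀`, `e₁` are translation vectors of chart-translating automorphisms has `θ_v(p_c(G,v)) = 0` at every vertex (`toFrmScaled`).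
builds on p205010 (kernel theorem, internal audit signed; external expert review pending). [cite: BenjaminiSchramm1996, Conj. 4; §2] -/
theorem frmFromSteps_criticalContinuity_holds {V : Type} (G : SimpleGraph V) [G.LocallyFinite] (Φ : PlanarSkeletonFrmFrom G)
    (hT : ∀ i : Fin 2, ∃ α : G ≃g G, ∀ w, Φ.φ (α w) = Φ.φ w + Pi.single i (1 : ℤ)) (v : V) :
    theta G v (criticalProbIOf G v) = 0 :=
  frmScaledSteps_criticalContinuity_holds G Φ.toFrmScaled le_rfl (fun i => by
    obtain ⟨α, hα⟩ := hT i
    exact ⟨α, fun w => by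
      show Φ.φ (α w) = Φ.φ w + Pi.single i ((1 : ℕ) : ℤ)
      rw [Nat.cast_one]
      exact hα w⟩) v

end Transplant

end Summit.CriticalPhenomena.PercolationContinuityZ3.Theorems

end
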